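import Summits.HubbardSuperconductivity.HubbardSuperconductivity.Theorems.WeakCouplingBCSKlLindhardEnclosureCrude

/-!
# KL-MARGIN-SCAN reader (22) «kernel-lindhard-enclosure» — the cell integral as an ITERATED INTERVAL INTEGRAL

Third generic brick for the square-cell rules: the Bochner integral of the two-shell integrand over a grid cell of `Momentum = EuclideanSpace ℝ
(Fin 2)` (the instrument's `Params.cellInt a b c d`) equals the iterated interval integral `∫_{a/U}^{b/U} ∫_{c/U}^{d/U} F(x, y) dy dx` in real
coordinates, for an oriented cell and an integrand integrable on the cell — the form in which `corner_mean_error_le` (`…CornerMean`) and the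
slice bounds (`…SliceRegularity`) are stated.  Route: pull back through `WithLp.ofLp` (`PiLp.volume_preserving_ofLp`,
`MeasurePreserving.setIntegral_preimage_emb`), then through `MeasurableEquiv.finTwoArrow` (`volume_preserving_finTwoArrow`), then Fubini for
set integrals (`setIntegral_prod`) and `Ico` ↔ interval integrals.  Honest framing: measure-theoretic plumbing only; nothing in this file asserts
a KL margin at any `t′ ≠ 0`, `K₃`, `U₀`, the window or B1g dominance; a Kohn–Luttinger instability statement is not ODLRO and nothing here
proves superconductivity in the Hubbard model.  (p1 g25, 2026-08-29.)
-/

noncomputable section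

set_option linter.dupNamespace false

namespace Summit.HubbardSuperconductivity.HubbardSuperconductivity.Theorems.KlLindhardEnclosure

open Real Set MeasureTheory Literature.MathematicalPhysics.QuantumLattice
open Summit.HubbardSuperconductivity.HubbardSuperconductivity.Theorems

/-- Real coordinates `(x, y)` ↦ the momentum `![x, y]`. -/
def pt (x y : ℝ) : Momentum := WithLp.toLp 2 ((MeasurableEquiv.finTwoArrow (α := ℝ)).symm (x, y))

/-- The coordinates of `pt x y`. -/
theorem pt_apply_zero (x y : ℝ) : pt x y 0 = x := by
  simp [pt, MeasurableEquiv.finTwoArrow, MeasurableEquiv.piFinTwo]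

/-- The coordinates of `pt x y`. -/
theorem pt_apply_one (x y : ℝ) : pt x y 1 = y := by
  simp [pt, MeasurableEquiv.finTwoArrow, MeasurableEquiv.piFinTwo]

/-- The coordinate box behind a grid cell, as a product set in `ℝ × ℝ` pulled back to `Fin 2 → ℝ`. -/
theorem Params.box_eq_preimage_prod (P : Params) (a b c d : ℤ) :
    Set.pi Set.univ (fun i => Ico ((![((P.toQ a : ℚ) : ℝ), ((P.toQ c : ℚ) : ℝ)] : Fin 2 → ℝ) i)
        ((![((P.toQ b : ℚ) : ℝ), ((P.toQ d : ℚ) : ℝ)] : Fin 2 → ℝ) i))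
      = (MeasurableEquiv.finTwoArrow (α := ℝ)) ⁻¹'
        (Ico ((P.toQ a : ℚ) : ℝ) ((P.toQ b : ℚ) : ℝ) ×ˢ Ico ((P.toQ c : ℚ) : ℝ) ((P.toQ d : ℚ) : ℝ)) := by
  ext v
  simp [Set.mem_pi, Fin.forall_fin_two, MeasurableEquiv.finTwoArrow, MeasurableEquiv.piFinTwo, Set.mem_prod]

/-- **THE CELL INTEGRAL AS AN ITERATED INTERVAL INTEGRAL**: for `0 < U`, an oriented cell (`a ≤ b`, `c ≤ d`) and an integrand integrable on it,
`cellInt a b c d = ∫_{a/U}^{b/U} ∫_{c/U}^{d/U} F(pt x y) dy dx`. -/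
theorem Params.cellInt_eq_iterated (P : Params) (hU : 0 < P.U) {a b c d : ℤ} (hab : a ≤ b) (hcd : c ≤ d)
    (hF : IntegrableOn P.integrand (P.cellSet a b c d) volume) :
    P.cellInt a b c d = ∫ x in ((a : ℝ) / (P.U : ℝ))..((b : ℝ) / (P.U : ℝ)),
      ∫ y in ((c : ℝ) / (P.U : ℝ))..((d : ℝ) / (P.U : ℝ)), P.integrand (pt x y) := by
  have hU' : (0 : ℝ) < (P.U : ℝ) := by exact_mod_cast hU
  -- names for the real box
  set ra := ((P.toQ a : ℚ) : ℝ) with hra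
  set rb := ((P.toQ b : ℚ) : ℝ) with hrb
  set rc := ((P.toQ c : ℚ) : ℝ) with hrc
  set rd := ((P.toQ d : ℚ) : ℝ) with hrd
  have era : ra = (a : ℝ) / (P.U : ℝ) := P.cast_toQ a
  have erb : rb = (b : ℝ) / (P.U : ℝ) := P.cast_toQ b
  have erc : rc = (c : ℝ) / (P.U : ℝ) := P.cast_toQ c
  have erd : rd = (d : ℝ) / (P.U : ℝ) := P.cast_toQ d
  have hab' : ra ≤ rb := by rw [era, erb]; exact div_le_div_of_nonneg_right (by exact_mod_cast hab) hU'.le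
  have hcd' : rc ≤ rd := by rw [erc, erd]; exact div_le_div_of_nonneg_right (by exact_mod_cast hcd) hU'.le
  -- step 1: pull back through ofLp
  set S : Set (Fin 2 → ℝ) := (MeasurableEquiv.finTwoArrow (α := ℝ)) ⁻¹' (Ico ra rb ×ˢ Ico rc rd) with hS
  have hcell : P.cellSet a b c d = (WithLp.ofLp : Momentum → (Fin 2 → ℝ)) ⁻¹' S := by
    rw [P.cellSet_eq_preimage, P.box_eq_preimage_prod]
  set G : (Fin 2 → ℝ) → ℝ := fun v => P.integrand (WithLp.toLp 2 v) with hG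
  have h1 : P.cellInt a b c d = ∫ v in S, G v := by
    unfold Params.cellInt
    rw [hcell]
    have := (PiLp.volume_preserving_ofLp (Fin 2)).setIntegral_preimage_emb
      (MeasurableEquiv.toLp 2 (Fin 2 → ℝ)).symm.measurableEmbedding G S
    simpa [hG] using this
  -- integrability transported
  have hG_int : IntegrableOn G S volume := by
    have := ((PiLp.volume_preserving_ofLp (Fin 2)).integrableOn_comp_preimage
      (MeasurableEquiv.toLp 2 (Fin 2 → ℝ)).symm.measurableEmbedding (f := G) (s := S)).mp
    apply this
    rw [← hcell]
    have e : G ∘ (WithLp.ofLp : Momentum → (Fin 2 → ℝ)) = P.integrand := by funext p; simp [hG]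
    rw [e]; exact hF
  -- step 2: through finTwoArrow to ℝ × ℝ
  set H : ℝ × ℝ → ℝ := fun z => G ((MeasurableEquiv.finTwoArrow (α := ℝ)).symm z) with hH
  have hHG : ∀ v, H (MeasurableEquiv.finTwoArrow (α := ℝ) v) = G v := fun v => by
    simp only [hH, MeasurableEquiv.symm_apply_apply]
  have h2 : (∫ v in S, G v) = ∫ z in Ico ra rb ×ˢ Ico rc rd, H z := by
    have key := (volume_preserving_finTwoArrow ℝ).setIntegral_preimage_emb
      (MeasurableEquiv.finTwoArrow (α := ℝ)).measurableEmbedding H (Ico ra rb ×ˢ Ico rc rd)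
    simp_rw [hHG] at key
    rw [hS]; exact key
  have hH_int : IntegrableOn H (Ico ra rb ×ˢ Ico rc rd) (volume.prod volume) := by
    have := ((volume_preserving_finTwoArrow ℝ).integrableOn_comp_preimage
      (MeasurableEquiv.finTwoArrow (α := ℝ)).measurableEmbedding (f := H) (s := Ico ra rb ×ˢ Ico rc rd)).mp
    have e : H ∘ (MeasurableEquiv.finTwoArrow (α := ℝ)) = G := funext hHG
    rw [e] at this
    exact this hG_int
  -- step 3: Fubini for set integrals
  have h3 : (∫ z in Ico ra rb ×ˢ Ico rc rd, H z) = ∫ x in Ico ra rb, ∫ y in Ico rc rd, H (x, y) := by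
    have := setIntegral_prod H hH_int
    simpa [Measure.volume_eq_prod] using this
  -- step 4: Ico ↦ interval integrals
  have h4 : (∫ x in Ico ra rb, ∫ y in Ico rc rd, H (x, y)) = ∫ x in ra..rb, ∫ y in rc..rd, H (x, y) := by
    rw [intervalIntegral.integral_of_le hab', setIntegral_congr_set Ico_ae_eq_Ioc]
    congr 1; funext x
    rw [intervalIntegral.integral_of_le hcd', setIntegral_congr_set Ico_ae_eq_Ioc]
  rw [h1, h2, h3, h4, era, erb, erc, erd]
  rfl

end Summit.HubbardSuperconductivity.HubbardSuperconductivity.Theorems.KlLindhardEnclosure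

end
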